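import Summits.Ventures.PercRepro.Night2BasisTargets

/-!
# night-2: the targets of a basis pair whose coloops off `K` contain a given subset `C` of the basis

For a basis pair `(B, z)` (`Q = insert z B`, `Q' = Q ∖ K`) and `C ⊆ Q'`, every target `T` with `C ⊆ coloops (T ∖ K)`
has `T ∖ K ∖ C ⊆ clF (Q ∖ C)` (both `T' ∖ C` and `Q' ∖ C` have rank `5 − |C|`), so these targets number at most
`2^{|(G ∩ clF (Q ∖ C)) ∖ Q|}` (`card_targets_coloops_subset_le`); in particular the targets with at least three coloops
off `K` — the only ones that can be saturated — are at most `Σ_{C ⊆ Q', |C| = 3} 2^{|(G ∩ clF (Q ∖ C)) ∖ Q|}`, with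
`clF (Q ∖ C)` the line through the two remaining points of `Q'` (and `K`) (`card_targets_three_le_coloops_le`).
-/

namespace PercRepro.Shadow

open PercRepro.ThmH PercRepro.PerFlat

variable {α : Type*} [DecidableEq α] {M : Matroid α} [M.Finite] {G : Finset α}

/-- Every point of a basis `Q'` (five points of rank `5`) is a coloop of `Q'`. -/
theorem coloops_eq_self_of_basis {Q' : Finset α} (hQ'g : Q' ⊆ gr M) (hc : Q'.card = 5) (hr : rkN M Q' = 5) : coloops M Q' = Q' := by
  ext w
  rw [mem_coloops]
  constructor
  · exact fun h => h.1
  · intro hw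
    refine ⟨hw, fun hcl => ?_⟩
    have h1 := rkN_le_card (M := M) (Q'.erase w)
    rw [Finset.card_erase_of_mem hw, hc] at h1
    have h2 := rkN_union_le_rkN_add_card (M := M) (Q'.erase w) {w}
    rw [Finset.card_singleton] at h2
    have h3 : Q'.erase w ∪ {w} = Q' := by
      rw [Finset.union_comm, ← Finset.insert_eq, Finset.insert_erase hw]
    rw [h3, hr] at h2
    -- `w ∈ clF (Q'.erase w)` would give `rk Q' = rk (Q'.erase w) ≤ 4`
    have h4 : rkN M (insert w (Q'.erase w)) = rkN M (Q'.erase w) := by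
      have hsub : insert w (Q'.erase w) ⊆ clF M (Q'.erase w) :=
        Finset.insert_subset hcl (subset_clF_of_subset_gr ((Finset.erase_subset _ _).trans hQ'g))
      have := rkN_mono (M := M) hsub
      rw [rkN_clF] at this
      have := rkN_mono (M := M) (Finset.subset_insert w (Q'.erase w))
      omega
    rw [Finset.insert_erase hw, hr] at h4
    omega

/-- **The targets of a basis pair whose coloops off `K` contain `C ⊆ Q'` number at most
`2^{|(G ∩ clF (Q ∖ C)) ∖ Q|}`.** -/
theorem card_targets_coloops_subset_le (hG : G ∈ flatsQ M (5 + 1)) (hd : (gr M \ G).card = 2)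
    (hk : kColoops M G = 1) {B : Finset α} (hB : B ∈ thinMembers M 5 G) (hnP : ¬ bigP M G B) {z : α}
    (hz : z ∈ G \ clF M B) {C : Finset α} (hC : C ⊆ insert z B \ coloops M G) :
    ((tgtSets M 5 G B z).filter (fun T => C ⊆ coloops M (T \ coloops M G))).card ≤
      2 ^ ((G ∩ clF M (insert z B \ C)) \ insert z B).card := by
  have hd' : (gr M \ G).card ≤ 5 := by omega
  have hGg : G ⊆ gr M := (mem_flatsQ.1 hG).1
  have hKB : coloops M G ⊆ B := coloops_subset_of_mem_thinMembers hG hd' hB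
  have hBG : B ⊆ G := subset_G_of_mem_thinMembers hB
  have hzG : z ∈ G := (Finset.mem_sdiff.1 hz).1
  have hQG : insert z B ⊆ G := Finset.insert_subset hzG hBG
  have hKQ : coloops M G ⊆ insert z B := hKB.trans (Finset.subset_insert _ _)
  set Q' := insert z B \ coloops M G with hQ'
  have hQ'g : Q' ⊆ gr M := Finset.sdiff_subset.trans (hQG.trans hGg)
  have hrQ' : rkN M Q' = 5 := by
    have h1 := rkN_eq_rkN_sdiff_add_one hG hk (S := insert z B) hQG (Finset.Subset.refl _) hKQ
    rw [rkN_insert_of_notMem_clF (hGg hzG) (Finset.mem_sdiff.1 hz).2, rkN_eq_five_of_mem_thinMembers hB,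
      ← hQ'] at h1
    omega
  have hcQ' : Q'.card = 5 := by
    have hB4 := card_sdiff_eq_four_of_not_bigP hG hd hk hB hnP
    have hzB : z ∉ B := fun h => (Finset.mem_sdiff.1 hz).2 (subset_clF_of_subset_gr (hBG.trans hGg) h)
    have hzK : z ∉ coloops M G := fun h => hzB (hKB h)
    rw [hQ', Finset.insert_sdiff_of_notMem _ hzK, Finset.card_insert_of_notMem (fun h => hzB (Finset.mem_sdiff.1 h).1), hB4]
  have hcolQ' : coloops M Q' = Q' := coloops_eq_self_of_basis hQ'g hcQ' hrQ'
  -- `rk (Q' ∖ C) = 5 − |C|`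
  have hrQC : rkN M (Q' \ C) + C.card = 5 := by
    have := rkN_sdiff_add_card_of_subset_coloops (M := M) hQ'g (T := C) (by rw [hcolQ']; exact hC)
    omega
  rw [← Finset.card_powerset]
  apply Finset.card_le_card_of_injOn (fun T => T \ insert z B)
  · intro T hT
    rw [Finset.mem_coe, Finset.mem_filter] at hT
    obtain ⟨hT, hCT⟩ := hT
    rw [Finset.mem_coe, Finset.mem_powerset]
    have hTG : T ⊆ G := subset_G_of_mem_shadowAt (mem_tgtSets.1 hT).1
    have hQT : insert z B ⊆ T := (mem_tgtSets.1 hT).2.1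
    set T' := T \ coloops M G with hT'
    have hT'g : T' ⊆ gr M := Finset.sdiff_subset.trans (hTG.trans hGg)
    have hQ'T' : Q' ⊆ T' := Finset.sdiff_subset_sdiff hQT (Finset.Subset.refl _)
    have hrT' : rkN M T' = 5 := by
      have h1 := rkN_mono (M := M) hQ'T'
      have h2 := rkN_mono (M := M) (show T' ⊆ G \ coloops M G from Finset.sdiff_subset_sdiff hTG (Finset.Subset.refl _))
      rw [rkN_sdiff_coloops_eq_five hG hk] at h2
      omega
    have hrTC : rkN M (T' \ C) + C.card = 5 := by
      have := rkN_sdiff_add_card_of_subset_coloops (M := M) hT'g (T := C) hCT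
      omega
    have hsub : Q' \ C ⊆ T' \ C := Finset.sdiff_subset_sdiff hQ'T' (Finset.Subset.refl _)
    have hcl : T' \ C ⊆ clF M (Q' \ C) := fun a ha =>
      mem_clF_of_rkN_eq hsub (Finset.sdiff_subset.trans hT'g) (by omega) ha
    intro a ha
    rw [Finset.mem_sdiff] at ha
    have haK : a ∉ coloops M G := fun h => ha.2 (hKQ h)
    have haC : a ∉ C := fun h => ha.2 (Finset.sdiff_subset (hC h))
    have haQ'C : a ∈ clF M (Q' \ C) := hcl (Finset.mem_sdiff.2 ⟨Finset.mem_sdiff.2 ⟨ha.1, haK⟩, haC⟩)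
    rw [Finset.mem_sdiff, Finset.mem_inter]
    exact ⟨⟨hTG ha.1, clF_mono (Finset.sdiff_subset_sdiff Finset.sdiff_subset (Finset.Subset.refl _)) haQ'C⟩, ha.2⟩
  · intro T hT T' hT' heq
    rw [Finset.mem_coe, Finset.mem_filter] at hT hT'
    have hQT : insert z B ⊆ T := (mem_tgtSets.1 hT.1).2.1
    have hQT' : insert z B ⊆ T' := (mem_tgtSets.1 hT'.1).2.1
    simp only at heq
    rw [← Finset.union_sdiff_of_subset hQT, ← Finset.union_sdiff_of_subset hQT', heq]

/-- **The targets with at least three coloops off `K`** (the only possibly saturated ones) number at most the sum over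
the three-point subsets `C` of `Q'` of `2^{|(G ∩ clF (Q ∖ C)) ∖ Q|}`. -/
theorem card_targets_three_le_coloops_le (hG : G ∈ flatsQ M (5 + 1)) (hd : (gr M \ G).card = 2)
    (hk : kColoops M G = 1) {B : Finset α} (hB : B ∈ thinMembers M 5 G) (hnP : ¬ bigP M G B) {z : α}
    (hz : z ∈ G \ clF M B) :
    ((tgtSets M 5 G B z).filter (fun T => 3 ≤ (coloops M (T \ coloops M G)).card)).card ≤
      ∑ C ∈ (insert z B \ coloops M G).powersetCard 3, 2 ^ ((G ∩ clF M (insert z B \ C)) \ insert z B).card := by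
  have hd' : (gr M \ G).card ≤ 5 := by omega
  have hGg : G ⊆ gr M := (mem_flatsQ.1 hG).1
  -- the coloops of a target off `K` lie in `Q'`
  have hcol : ∀ T ∈ tgtSets M 5 G B z, coloops M (T \ coloops M G) ⊆ insert z B \ coloops M G := by
    intro T hT w hw
    have hTG : T ⊆ G := subset_G_of_mem_shadowAt (mem_tgtSets.1 hT).1
    have hQT : insert z B ⊆ T := (mem_tgtSets.1 hT).2.1
    have hwT : w ∈ T \ coloops M G := (mem_coloops.1 hw).1
    by_contra hwQ
    have hQ'T' : insert z B \ coloops M G ⊆ (T \ coloops M G).erase w := fun a ha =>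
      Finset.mem_erase.2 ⟨fun h => hwQ (h ▸ ha), Finset.sdiff_subset_sdiff hQT (Finset.Subset.refl _) ha⟩
    have hT'g : T \ coloops M G ⊆ gr M := Finset.sdiff_subset.trans (hTG.trans hGg)
    have hzG : z ∈ G := (Finset.mem_sdiff.1 hz).1
    have hQG : insert z B ⊆ G := Finset.insert_subset hzG (subset_G_of_mem_thinMembers hB)
    have hKQ : coloops M G ⊆ insert z B :=
      (coloops_subset_of_mem_thinMembers hG hd' hB).trans (Finset.subset_insert _ _)
    have hrQ' : rkN M (insert z B \ coloops M G) = 5 := by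
      have h1 := rkN_eq_rkN_sdiff_add_one hG hk (S := insert z B) hQG (Finset.Subset.refl _) hKQ
      rw [rkN_insert_of_notMem_clF (hGg hzG) (Finset.mem_sdiff.1 hz).2, rkN_eq_five_of_mem_thinMembers hB] at h1
      omega
    have h5 : rkN M (T \ coloops M G) ≤ 5 := by
      have := rkN_mono (M := M) (show T \ coloops M G ⊆ G \ coloops M G from
        Finset.sdiff_subset_sdiff hTG (Finset.Subset.refl _))
      rw [rkN_sdiff_coloops_eq_five hG hk] at this
      exact this
    have h1 : w ∈ clF M (insert z B \ coloops M G) :=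
      mem_clF_of_rkN_eq (Finset.sdiff_subset_sdiff hQT (Finset.Subset.refl _)) hT'g (by
        have := rkN_mono (M := M) (Finset.sdiff_subset_sdiff hQT (Finset.Subset.refl _) :
          insert z B \ coloops M G ⊆ T \ coloops M G)
        omega) hwT
    exact (mem_coloops.1 hw).2 (clF_mono hQ'T' h1)
  -- a target with ≥ 3 coloops contains a three-point subset of `Q'` among its coloops
  calc ((tgtSets M 5 G B z).filter (fun T => 3 ≤ (coloops M (T \ coloops M G)).card)).card
      ≤ (((insert z B \ coloops M G).powersetCard 3).biUnion (fun C =>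
          (tgtSets M 5 G B z).filter (fun T => C ⊆ coloops M (T \ coloops M G)))).card := by
        apply Finset.card_le_card
        intro T hT
        rw [Finset.mem_filter] at hT
        obtain ⟨C, hCsub, hC3⟩ := Finset.exists_subset_card_eq hT.2
        rw [Finset.mem_biUnion]
        exact ⟨C, Finset.mem_powersetCard.2 ⟨hCsub.trans (hcol T hT.1), hC3⟩, Finset.mem_filter.2 ⟨hT.1, hCsub⟩⟩
    _ ≤ ∑ C ∈ (insert z B \ coloops M G).powersetCard 3, ((tgtSets M 5 G B z).filter
          (fun T => C ⊆ coloops M (T \ coloops M G))).card := Finset.card_biUnion_le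
    _ ≤ ∑ C ∈ (insert z B \ coloops M G).powersetCard 3, 2 ^ ((G ∩ clF M (insert z B \ C)) \ insert z B).card := by
        apply Finset.sum_le_sum
        intro C hC
        exact card_targets_coloops_subset_le hG hd hk hB hnP hz (Finset.mem_powersetCard.1 hC).1

end PercRepro.Shadow
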